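import Literature.Probability.LatticeModels.LatticeGraph
import Mathlib.Algebra.Group.ForwardDiff
import Mathlib.Data.ZMod.ValMinAbs
import Mathlib.Analysis.Normed.Group.Basic
import HarnessLib

/-!
# Differences of sampled symbols on the torus: reduction to differences on the integer lattice

Topic `Literature/Probability/LatticeModels`; the bookkeeping between `TorusFourierDecayFromDifferences.lean` (decay
of a character sum on `(ℤ/Pℤ)^d` from the iterated differences `Δ_v̄^N G` of its symbol `G`, `v̄` the reduction of
an integer step `v`) and `Analysis/Calculus/IteratedDifferenceDerivBound.lean` (differences of a smooth function
along a vector are small).  The symbols of lattice fermion propagators are SAMPLES of a continuum symbol: in the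
spatial directions `G(k) = Φ(2πk̃/L)` with `k̃ = valMinAbs k` the centred representative (the central copy of the
Brillouin zone), in the time direction `G(i) = Φ(π(2(i - M) + 1)/β)` with `i = val` the plain representative of the
Matsubara index (`HubbardFreeCovariance.matsubaraFreq`).  Writing `G = f ∘ R` with `R` a coordinatewise section of
`ℤ^d → (ℤ/Pℤ)^d` and `f` a function on `ℤ^d`:

* `fwdDiff_iter_comp_addMonoidHom` — differences commute with additive reparametrisations:
  `Δ_v^N (m ↦ Φ(c + φ m)) = (Δ_{φ v}^N Φ)(c + φ ·)`;
* **`fwdDiff_iter_comp_section`** — `Δ_v̄^N (f ∘ R) = (Δ_v^N f) ∘ R` as soon as `f(R a + t v) = f(R(a + t v̄))` for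
  `t ≤ N` (the sampled segment does not notice the wrap-around);
* `section_consistent_val`, `section_consistent_valMinAbs` — that consistency holds when `f` VANISHES near the
  seam: for `R = val`, if `f m = 0` whenever some `m_j < N|v_j|` or `m_j ≥ P - N|v_j|`; for `R = valMinAbs`, if
  `f m = 0` whenever some `2|m_j| ≥ P - 2N|v_j|` (a symbol supported well inside the zone / the frequency window);
* **`sum_norm_fwdDiff_iter_comp_section_le`** — then `Σ_a ‖(Δ_v̄^N G)(a)‖ ≤ (N+1) · #{a : G a ≠ 0} · K` for any bound
  `K` of `‖(Δ_v^N f)(R a)‖`: the number of momenta in the support times the size of the `N`-th difference — the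
  right-hand side of the decay bound `norm_sum_torusChar_smul_mul_pow_le`.

Everything is proved; no definitions, no named facts. [folklore]

## Sources

G. Benfatto, A. Giuliani, V. Mastropietro, Ann. Henri Poincaré 7 (2006) 809–898, (2.36aa) and footnote ¹
(`BenfattoGiulianiMastropietro2006`).  Routine ("folklore").
-/

noncomputable section

open Finset

namespace Literature.Probability.LatticeModels

/-! ### Differences commute with additive reparametrisations -/

/-- **Differences commute with additive reparametrisations**: for an additive map `φ : A → V`, a base point `c` and
any `Φ : V → E`, `(Δ_v^N (m ↦ Φ(c + φ m)))(m) = (Δ_{φ v}^N Φ)(c + φ m)`. [folklore] -/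
theorem fwdDiff_iter_comp_addMonoidHom {A V E : Type*} [AddCommMonoid A] [AddCommMonoid V] [AddCommGroup E]
    (φ : A →+ V) (c : V) (Φ : V → E) (v : A) (N : ℕ) (m : A) :
    ((fwdDiff v)^[N] fun m : A => Φ (c + φ m)) m = ((fwdDiff (φ v))^[N] Φ) (c + φ m) := by
  rw [fwdDiff_iter_eq_sum_shift, fwdDiff_iter_eq_sum_shift]
  refine sum_congr rfl fun k _ => ?_
  rw [map_add, map_nsmul, add_assoc]

/-! ### Sections of the torus -/

section Section

variable {d P : ℕ} {E : Type*} [AddCommGroup E]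

/-- **Differences of a sampled symbol**: let `r : ℤ/Pℤ → ℤ` be any map and `f : ℤ^d → E`; if the sampled segments do
not notice the wrap-around, `f(R a + t v) = f(R(a + t v̄))` for all `a` and `t ≤ N` (`R = r` coordinatewise,
`v̄ = v mod P`), then `Δ_v̄^N (f ∘ R) = (Δ_v^N f) ∘ R`. [folklore] -/
theorem fwdDiff_iter_comp_section (r : ZMod P → ℤ) (f : (Fin d → ℤ) → E) (v : Fin d → ℤ) (N : ℕ)
    (hf : ∀ (a : TorusSite d P) (t : ℕ), t ≤ N →
      f (fun j => r (a j) + t * v j) = f (fun j => r (a j + (t : ZMod P) * (v j : ZMod P))))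
    (a : TorusSite d P) :
    ((fwdDiff (fun j => (v j : ZMod P)))^[N] (fun b : TorusSite d P => f (fun j => r (b j)))) a =
      ((fwdDiff v)^[N] f) (fun j => r (a j)) := by
  rw [fwdDiff_iter_eq_sum_shift, fwdDiff_iter_eq_sum_shift]
  refine sum_congr rfl fun t ht => ?_
  congr 1
  have h1 : (fun j => r (a j)) + t • v = fun j => r (a j) + t * v j := by
    ext j; simp [Pi.add_apply, nsmul_eq_mul]
  have h2 : (fun j => r ((a + t • fun j => (v j : ZMod P)) j)) = fun j => r (a j + (t : ZMod P) * (v j : ZMod P)) := by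
    ext j; simp [Pi.add_apply, nsmul_eq_mul]
  rw [h1, h2, hf a t (Nat.lt_succ_iff.1 (mem_range.1 ht))]

/-- `|t v| ≤ N|v|` for `t ≤ N`. [folklore] -/
theorem abs_natCast_mul_le {t N : ℕ} (ht : t ≤ N) (w : ℤ) : |(t : ℤ) * w| ≤ N * |w| := by
  rw [abs_mul, Nat.abs_cast]
  exact mul_le_mul_of_nonneg_right (by exact_mod_cast ht) (abs_nonneg w)

/-- **Consistency of the plain section** `R = val` (the time direction): if `f m = 0` whenever some coordinate has
`m_j < N|v_j|` or `m_j + N|v_j| ≥ P`, the sampled segments of length `N` do not notice the seam at `0 ≡ P`. [folklore] -/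
theorem section_consistent_val [NeZero P] (f : (Fin d → ℤ) → E) (v : Fin d → ℤ) (N : ℕ)
    (hsupp : ∀ m : Fin d → ℤ, (∃ j, m j < N * |v j| ∨ (P : ℤ) ≤ m j + N * |v j|) → f m = 0)
    (a : TorusSite d P) (t : ℕ) (ht : t ≤ N) :
    f (fun j => ((a j).val : ℤ) + t * v j) = f (fun j => (((a j + (t : ZMod P) * (v j : ZMod P)).val : ℕ) : ℤ)) := by
  by_cases hin : ∀ j, 0 ≤ ((a j).val : ℤ) + t * v j ∧ ((a j).val : ℤ) + t * v j < P
  · -- no wrap: the two argument vectors coincide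
    congr 1
    ext j
    obtain ⟨h0, hP⟩ := hin j
    have hcast : (a j + (t : ZMod P) * (v j : ZMod P)) = (((((a j).val : ℤ) + t * v j) : ℤ) : ZMod P) := by
      push_cast
      rw [ZMod.natCast_zmod_val]
    rw [hcast, ZMod.val_intCast, Int.emod_eq_of_lt h0 hP]
  · -- a wrap in coordinate `j`: both sides vanish
    push Not at hin
    obtain ⟨j, hj⟩ := hin
    have hval0 : (0 : ℤ) ≤ (a j).val := Int.natCast_nonneg _
    have hvalP : ((a j).val : ℤ) < P := by exact_mod_cast ZMod.val_lt (a j)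
    have htv : |(t : ℤ) * v j| ≤ N * |v j| := abs_natCast_mul_le ht (v j)
    have htv1 := abs_le.1 htv
    have hout : ((a j).val : ℤ) + t * v j < 0 ∨ (P : ℤ) ≤ ((a j).val : ℤ) + t * v j := by
      by_contra h
      push Not at h
      exact absurd (hj h.1) (not_le.2 h.2)
    -- the left-hand side vanishes
    have hL : f (fun j => ((a j).val : ℤ) + t * v j) = 0 := by
      refine hsupp _ ⟨j, ?_⟩
      rcases hout with h | h
      · left; linarith [abs_nonneg (v j), mul_nonneg (Nat.cast_nonneg N : (0 : ℤ) ≤ N) (abs_nonneg (v j))]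
      · right; linarith [abs_nonneg (v j), mul_nonneg (Nat.cast_nonneg N : (0 : ℤ) ≤ N) (abs_nonneg (v j))]
    -- the right-hand side vanishes: its `j`-th coordinate is the reduction `m' ∈ [0, P)` of a number outside `[0, P)`
    have hR : f (fun j => (((a j + (t : ZMod P) * (v j : ZMod P)).val : ℕ) : ℤ)) = 0 := by
      refine hsupp _ ⟨j, ?_⟩
      have hm'0 : (0 : ℤ) ≤ (((a j + (t : ZMod P) * (v j : ZMod P)).val : ℕ) : ℤ) := Int.natCast_nonneg _
      have hm'P : (((a j + (t : ZMod P) * (v j : ZMod P)).val : ℕ) : ℤ) < P := by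
        exact_mod_cast ZMod.val_lt (a j + (t : ZMod P) * (v j : ZMod P))
      -- `m' ≡ val + t v (mod P)`
      have hmod : (P : ℤ) ∣ (((a j).val : ℤ) + t * v j) - (((a j + (t : ZMod P) * (v j : ZMod P)).val : ℕ) : ℤ) := by
        rw [← ZMod.intCast_zmod_eq_zero_iff_dvd]
        push_cast
        rw [ZMod.natCast_zmod_val, ZMod.natCast_zmod_val]
        ring
      generalize (((a j + (t : ZMod P) * (v j : ZMod P)).val : ℕ) : ℤ) = m' at hm'0 hm'P hmod ⊢
      obtain ⟨q, hq⟩ := hmod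
      have hP0 : (0 : ℤ) < P := by exact_mod_cast Nat.pos_of_ne_zero (NeZero.ne P)
      by_contra hcon
      push Not at hcon
      obtain ⟨hc1, hc2⟩ := hcon
      rcases hout with h | h
      · -- `val + tv < 0`, so `q ≤ -1`
        have hq1 : q ≤ -1 := by
          by_contra hq'
          push Not at hq'
          have : 0 ≤ q := by omega
          nlinarith
        have : (P : ℤ) * q ≤ -P := by nlinarith
        linarith
      · -- `val + tv ≥ P`, so `q ≥ 1`
        have hq1 : 1 ≤ q := by
          by_contra hq'
          push Not at hq'
          have : q ≤ 0 := by omega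
          nlinarith
        have : (P : ℤ) ≤ (P : ℤ) * q := by nlinarith
        linarith
    rw [hL, hR]

/-- **Consistency of the centred section** `R = valMinAbs` (the spatial directions): if `f m = 0` whenever some
coordinate has `2|m_j| + 2N|v_j| ≥ P`, the sampled segments of length `N` do not notice the seam at `±P/2`. [folklore] -/
theorem section_consistent_valMinAbs [NeZero P] (f : (Fin d → ℤ) → E) (v : Fin d → ℤ) (N : ℕ)
    (hsupp : ∀ m : Fin d → ℤ, (∃ j, (P : ℤ) ≤ 2 * |m j| + 2 * N * |v j|) → f m = 0)
    (a : TorusSite d P) (t : ℕ) (ht : t ≤ N) :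
    f (fun j => (a j).valMinAbs + t * v j) = f (fun j => (a j + (t : ZMod P) * (v j : ZMod P)).valMinAbs) := by
  by_cases hin : ∀ j, ((a j).valMinAbs + t * v j) * 2 ∈ Set.Ioc (-(P : ℤ)) P
  · -- no wrap
    congr 1
    ext j
    symm
    rw [ZMod.valMinAbs_spec]
    refine ⟨?_, hin j⟩
    simp [ZMod.coe_valMinAbs]
  · push Not at hin
    obtain ⟨j, hj⟩ := hin
    have hP0 : (0 : ℤ) < P := by exact_mod_cast Nat.pos_of_ne_zero (NeZero.ne P)
    have htv : |(t : ℤ) * v j| ≤ N * |v j| := abs_natCast_mul_le ht (v j)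
    have htv1 := abs_le.1 htv
    have ha2 : (a j).valMinAbs * 2 ∈ Set.Ioc (-(P : ℤ)) P := (a j).valMinAbs_mem_Ioc
    obtain ⟨ha2l, ha2r⟩ := ha2
    -- `|ã + tv| · 2 ≥ P` (outside the window)
    have hout : ((a j).valMinAbs + t * v j) * 2 ≤ -(P : ℤ) ∨ (P : ℤ) < ((a j).valMinAbs + t * v j) * 2 := by
      by_contra h
      push Not at h
      exact hj ⟨h.1, h.2⟩
    have hL : f (fun j => (a j).valMinAbs + t * v j) = 0 := by
      refine hsupp _ ⟨j, ?_⟩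
      rcases hout with h | h
      · have : ((a j).valMinAbs + t * v j) ≤ 0 := by linarith
        rw [abs_of_nonpos this]
        nlinarith [abs_nonneg (v j)]
      · have : 0 ≤ ((a j).valMinAbs + t * v j) := by linarith
        rw [abs_of_nonneg this]
        nlinarith [abs_nonneg (v j)]
    have hR : f (fun j => (a j + (t : ZMod P) * (v j : ZMod P)).valMinAbs) = 0 := by
      refine hsupp _ ⟨j, ?_⟩
      have hm'2 : (a j + (t : ZMod P) * (v j : ZMod P)).valMinAbs * 2 ∈ Set.Ioc (-(P : ℤ)) P :=
        (a j + (t : ZMod P) * (v j : ZMod P)).valMinAbs_mem_Ioc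
      have hmod : (P : ℤ) ∣ ((a j).valMinAbs + t * v j) - (a j + (t : ZMod P) * (v j : ZMod P)).valMinAbs := by
        rw [← ZMod.intCast_zmod_eq_zero_iff_dvd]
        simp [ZMod.coe_valMinAbs]
      generalize (a j + (t : ZMod P) * (v j : ZMod P)).valMinAbs = m' at hm'2 hmod ⊢
      obtain ⟨hm'l, hm'r⟩ := hm'2
      obtain ⟨q, hq⟩ := hmod
      by_contra hcon
      push Not at hcon
      have habs : 2 * |m'| < (P : ℤ) - 2 * N * |v j| := by linarith
      rcases hout with h | h
      · have hq1 : q ≤ -1 := by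
          by_contra hq'
          push Not at hq'
          have : 0 ≤ q := by omega
          nlinarith [abs_nonneg m', neg_abs_le m', le_abs_self m']
        have : (P : ℤ) * q ≤ -P := by nlinarith
        nlinarith [abs_nonneg m', neg_abs_le m', le_abs_self m', abs_nonneg (v j)]
      · have hq1 : 1 ≤ q := by
          by_contra hq'
          push Not at hq'
          have : q ≤ 0 := by omega
          nlinarith [abs_nonneg m', neg_abs_le m', le_abs_self m']
        have : (P : ℤ) ≤ (P : ℤ) * q := by nlinarith
        nlinarith [abs_nonneg m', neg_abs_le m', le_abs_self m', abs_nonneg (v j)]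
    rw [hL, hR]

end Section

/-! ### The support count -/

section Count

variable {d P : ℕ} {E : Type*} [NormedAddCommGroup E]

/-- If all sampled values on the segment vanish, so does the difference. [folklore] -/
theorem fwdDiff_iter_eq_zero_of_forall {A : Type*} [AddCommMonoid A] (f : A → E) (v : A) (N : ℕ) (m : A)
    (h : ∀ t : ℕ, t ≤ N → f (m + t • v) = 0) : ((fwdDiff v)^[N] f) m = 0 := by
  rw [fwdDiff_iter_eq_sum_shift]
  exact sum_eq_zero fun t ht => by rw [h t (Nat.lt_succ_iff.1 (mem_range.1 ht)), smul_zero]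

/-- **The `ℓ¹` size of the differences of a sampled symbol**: under the consistency hypothesis of
`fwdDiff_iter_comp_section`, `Σ_a ‖(Δ_v̄^N (f ∘ R))(a)‖ ≤ (N+1) · #{a : f(R a) ≠ 0} · K` for every bound `K` of the
differences `‖(Δ_v^N f)(R a)‖` on the torus (the support count: a difference at `a` involves only the `N+1` samples
`R a + t v`, each nonzero on a translate of the support). [folklore] -/
theorem sum_norm_fwdDiff_iter_comp_section_le [NeZero P] (r : ZMod P → ℤ) (f : (Fin d → ℤ) → E) (v : Fin d → ℤ)
    (N : ℕ) (hf : ∀ (a : TorusSite d P) (t : ℕ), t ≤ N →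
      f (fun j => r (a j) + t * v j) = f (fun j => r (a j + (t : ZMod P) * (v j : ZMod P))))
    {K : ℝ} (hK : ∀ a : TorusSite d P, ‖((fwdDiff v)^[N] f) (fun j => r (a j))‖ ≤ K)
    [DecidablePred fun a : TorusSite d P => f (fun j => r (a j)) ≠ 0] :
    ∑ a : TorusSite d P, ‖((fwdDiff (fun j => (v j : ZMod P)))^[N] (fun b : TorusSite d P => f (fun j => r (b j)))) a‖ ≤
      ((N : ℝ) + 1) * ((univ.filter fun a : TorusSite d P => f (fun j => r (a j)) ≠ 0).card : ℝ) * K := by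
  have hK0 : 0 ≤ K := (norm_nonneg _).trans (hK 0)
  -- (1) rewrite through the section
  have h0 : ∀ a : TorusSite d P, ‖((fwdDiff (fun j => (v j : ZMod P)))^[N] (fun b : TorusSite d P => f (fun j => r (b j)))) a‖ =
      ‖((fwdDiff v)^[N] f) (fun j => r (a j))‖ := fun a => by rw [fwdDiff_iter_comp_section r f v N hf a]
  rw [sum_congr rfl fun a _ => h0 a]
  -- (2) the differences vanish off `N+1` translates of the support
  set C : Finset (TorusSite d P) := (range (N + 1)).biUnion fun t =>
    (univ.filter fun a : TorusSite d P => f (fun j => r (a j)) ≠ 0).image fun b => b - t • fun j => (v j : ZMod P) with hC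
  have hzero : ∀ a : TorusSite d P, a ∉ C → ((fwdDiff v)^[N] f) (fun j => r (a j)) = 0 := by
    intro a hnot
    refine fwdDiff_iter_eq_zero_of_forall f v N _ fun t ht => ?_
    by_contra hft
    apply hnot
    refine mem_biUnion.2 ⟨t, mem_range.2 (Nat.lt_succ_iff.2 ht),
      mem_image.2 ⟨a + t • fun j => (v j : ZMod P), ?_, add_sub_cancel_right _ _⟩⟩
    refine mem_filter.2 ⟨mem_univ _, ?_⟩
    have h1 : (fun j => r (a j)) + t • v = fun j => r (a j) + t * v j := by
      ext j; simp [nsmul_eq_mul]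
    have h2 : (fun j => r ((a + t • fun j => (v j : ZMod P)) j)) = fun j => r (a j + (t : ZMod P) * (v j : ZMod P)) := by
      ext j; simp [nsmul_eq_mul]
    rw [h2, ← hf a t ht, ← h1]
    exact hft
  have hsum : ∑ a : TorusSite d P, ‖((fwdDiff v)^[N] f) (fun j => r (a j))‖ =
      ∑ a ∈ C, ‖((fwdDiff v)^[N] f) (fun j => r (a j))‖ :=
    (sum_subset (subset_univ C) fun a _ ha => by rw [hzero a ha, norm_zero]).symm
  have hcardC : (C.card : ℝ) ≤ ((N : ℝ) + 1) * ((univ.filter fun a : TorusSite d P => f (fun j => r (a j)) ≠ 0).card : ℝ) := by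
    have h2 := card_biUnion_le (s := range (N + 1)) (t := fun t =>
      (univ.filter fun a : TorusSite d P => f (fun j => r (a j)) ≠ 0).image fun b => b - t • fun j => (v j : ZMod P))
    have h3 : ∑ t ∈ range (N + 1), ((univ.filter fun a : TorusSite d P => f (fun j => r (a j)) ≠ 0).image
        fun b => b - t • fun j => (v j : ZMod P)).card ≤
        ∑ _t ∈ range (N + 1), (univ.filter fun a : TorusSite d P => f (fun j => r (a j)) ≠ 0).card :=
      sum_le_sum fun t _ => card_image_le
    rw [sum_const, card_range, smul_eq_mul] at h3
    have h4 : C.card ≤ (N + 1) * (univ.filter fun a : TorusSite d P => f (fun j => r (a j)) ≠ 0).card := h2.trans h3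
    exact_mod_cast h4
  -- (3) assemble
  rw [hsum]
  calc ∑ a ∈ C, ‖((fwdDiff v)^[N] f) (fun j => r (a j))‖ ≤ ∑ _a ∈ C, K := sum_le_sum fun a _ => hK a
    _ = (C.card : ℝ) * K := by rw [sum_const, nsmul_eq_mul]
    _ ≤ ((N : ℝ) + 1) * ((univ.filter fun a : TorusSite d P => f (fun j => r (a j)) ≠ 0).card : ℝ) * K :=
        mul_le_mul_of_nonneg_right hcardC hK0

end Count

end Literature.Probability.LatticeModels
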